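import Summits.AtomisticToContinuum.Crystallization.Theorems.FrustratedLawDichotomyStrainedPatchHomEntryLeafHTA2QCellG80XV1

/-!
# v3 ANCHOR CELL (T0) `cT080 × wG80X` (0.80 t_b, SIX-coarse: 2⁻¹⁰ on (0,0),(1,1),(0,1), 2⁻⁹ else (k₆ = 3½)), part 2: the p-dependent kernel facts `restG80XV` (≈ 80 s) and `linG80XV` (sharp linear pieces)
# (27623 `(H) HomFloor (1/625)`, hcp half; pre-staged by hand-1 g37, LANDED by hand-1 g38 on critic GO row 1436 (E) / 1437 (E) «T0 anchors»)

Kernel facts; 0 sorry; standard axioms.  `--supports stmt-AtomisticToContinuum-27623`.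
-/

namespace Summit.AtomisticToContinuum.Crystallization.Theorems.FrustratedLawDichotomyStrainedPatchHomEntryLeafHT

open Literature.Analysis.ValidatedNumerics.Numerics
open Summit.AtomisticToContinuum.Crystallization.Theorems.FrustratedLawDichotomyStrainedPatchHomCertTree (CertTree treeOK)
open Summit.AtomisticToContinuum.Crystallization.Theorems.FrustratedLawDichotomyStrainedPatchHomEntryTable (muRec)
open Summit.AtomisticToContinuum.Crystallization.Theorems.FrustratedLawDichotomyStrainedPatchHomEntryFitHcpCentred (entryLeafOKHQDCRS)
open Summit.AtomisticToContinuum.Crystallization.Theorems.FrustratedLawDichotomyStrainedPatchHomSlopeLJ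
open Summit.AtomisticToContinuum.Crystallization.Theorems.FrustratedLawDichotomyStrainedPatchHomSlopeLJAffine
open Summit.AtomisticToContinuum.Crystallization.Theorems.FrustratedLawDichotomyStrainedPatchHomSlopeLJAffine2Kit
open Summit.AtomisticToContinuum.Crystallization.Theorems.FrustratedLawDichotomyStrainedPatchHomSlopeLJAffine2KitS (rem3LJS)
open Summit.AtomisticToContinuum.Crystallization.Theorems.FrustratedLawDichotomyStrainedPatchHomEntryFitTolerance (cT080)

set_option maxRecDepth 100000 in
set_option maxHeartbeats 4000000 in
/-- ★ KERNEL: the non-slope conjuncts of the certificate side for `pG80XV`. -/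
theorem restG80XV : htCertRestA2 pG80XV JG80X cT080 wG80X = true := by
  decide +kernel

set_option maxRecDepth 100000 in
set_option maxHeartbeats 4000000 in
/-- ★ KERNEL: `g₀ + lin + ⌈√ΣQ²⌉ + rem3♯ + nai = 703880161305 ≤ GnG80XV` (sharp third-order remainder `rem3LJS`). -/
theorem linG80XV : g0LJ cT080 (htScA2F cT080 wG80X JG80X (htNearU cT080 wG80X)) + linLJA cT080 wG80X JG80X (htScA2F cT080 wG80X JG80X (htNearU cT080 wG80X)) + sqrtQ QG80X +
    rem3LJS cT080 wG80X JG80X (htScA2F cT080 wG80X JG80X (htNearU cT080 wG80X)) + naiSLJ cT080 (hullW JG80X wG80X) (htSnA2F cT080 wG80X JG80X (htNearU cT080 wG80X)) ≤ GnG80XV := by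
  decide +kernel

end Summit.AtomisticToContinuum.Crystallization.Theorems.FrustratedLawDichotomyStrainedPatchHomEntryLeafHT
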